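import Literature.MathematicalPhysics.QuantumFieldTheory.Balaban1983to89.B9Eq326DeltaAHermitianZdCurved
import Literature.MathematicalPhysics.QuantumFieldTheory.Balaban1983to89.B9Eq316AveragingTransposeZdLevelZero

/-!
# `Balaban1983to89.B9Thm311LinHermCubeZd` — [Balaban1985BackgroundPropagators] (3.26) p. 395, Thm 3.11 p. 416 at PRINT'S CLASS: for the four-letter record `opsAllZd`
# over print's averaging class `cubeLamBP` of a cube member, `Δ_a(U₀)` is ℝ-linear AND Hermitian-preserving at EVERY unitary background — dag-n06-b's displayed
# structural binder `LinHermInClassAt` of the per-member Theorem-3.11 road is a THEOREM there (all `c₃₅`, `a₃`), so `InvAtH` for `G_𝔤` follows from `PosDefInClassAtH` ALONE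

statement-level skeleton of published theorems with citation tags; proofs where landed; nothing here is a claim about the
Yang–Mills mass gap

PDF held: `paper:balaban1985-cmp99-background-propagators` p. 391 (𝔤-valued bond functions), (3.16) p. 393, (3.26)–(3.27) p. 395, Thm 3.11 p. 416; [Balaban1985RegularSpaces] (1.31)
p. 82, (1.131) p. 99 — through the audited headers of dag-n06-b's `B9Eq327GreenZdHerm` (`LinHermInClassAt ∕ PosDefInClassAtH ∕ invAtH_withGopZdH_of_posDefH`) and
`B9Eq316AveragingTransposeZdLevelZero` (edition P₀: `hbox0_cubeLamBP_of_eq`, `linearOnDomAt_opsAllZd_cubeLamBP`), and this seat's `B9Eq326DeltaAHermitianZdCurved`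
(`hermPreservingAt_opsAllZd_of_box`) — BY NAME.

WHY THIS FILE (cell `pub-ymgap`, HUMAN RULING D-0062 ∕ D-0149; seat `pub-ymgap-dag-n06-w2` (g3), node N06 = [B9]; CLAIM-5; count-neutral).  dag-n06-b g18's per-member road
(`B9Eq327GreenZdHerm` §5) reads `InvAtH (withGopZdH ops)` ⟸ `RegularInClassAtH` ⟸ `LinHermInClassAt ∧ PosDefInClassAtH`, both DISPLAYED.  For print's class `cubeLamBP`
the level-0 crossing bonds defeat every box-clause supplier of the first (LOCATED-SELF-5); n06-b g19's edition P₀ (`linearOnDomAt_opsAllZd_cubeLamBP`, every unitary `U₀`)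
and this seat's `hermPreservingAt_opsAllZd_of_box` (P₀ clause, every unitary `U₀`) now give BOTH halves at every unitary background, hence `LinHermInClassAt` for every
`(c₃₅, a₃)` — the structural binder is gone; what the road still displays at print's class is `PosDefInClassAtH` (Theorem 3.11's positivity) only.

WHAT IS PROVED (kernel, 0 sorry; proof lane — no `def`).
* §1 ★ `hermPreservingAt_opsAllZd_cubeLamBP` (every unitary `U₀`, every cube member `i.Ω = cubeFam false L a M_c ρ i.k` with finite `□₀`, `m ≤ i.k`, `2 ≤ L ≤ ρ`, faithful
  Hermitian tracial `τ` on a finite-dimensional fibre) · `linHerm_opsAllZd_cubeLamBP` (both halves at every unitary `U₀`).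
* §2 ★★ `linHermInClassAt_opsAllZd_of_box` (any member obeying the P₀ box law: the binder holds for every `(c₃₅, a₃)`, at any `bg ∕ ιCfg`) · ★★★
  `linHermInClassAt_opsAllZd_cubeLamBP` (print's class) · ★★★ `invAtH_withGopZdH_opsAllZd_cubeLamBP_of_posDefH` (`PosDefInClassAtH ⟹ InvAtH (withGopZdH (opsAllZd …))`
  at print's class — dag-n06-b's `invAtH_withGopZdH_of_posDefH` with its structural input discharged).
HONEST SCOPE.  By-name composition; no estimate; `PosDefInClassAtH` (Thm 3.11's positivity at the member's class, uniform in `U₀`) is NOT proved — it stays the displayed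
input; count-neutral; N05∕N06 NOT discharged; one finite lattice programme at fixed `ε`; R4 closes the conditional finite-𝕋⁴ rung `BalabanLadder.UV` only; nothing
continuum ∕ ℝ⁴ ∕ OS ∕ mass-gap ∕ Clay.  Unit `pub-ymgap-dag-n06-w2` (g3), 2026-08-28.
-/

noncomputable section

namespace Literature.MathematicalPhysics.QuantumFieldTheory.Balaban1983to89.B9Thm311LinHermCubeZd

open B7Prop1Local (InBox loK bondHiK)
open B7Prop2Explicit (unitaryUnits)
open B8LeafModelZd (ZdIdx)
open B8Eq131CubesAdmissible (cubeFam)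
open B8Ineq159FlatCubeMemberPrinted (cubeLamBP)
open B9SupplySockB9P3ZdLetters (OpsZd)
open B9SupplySockB9P3ZdAtHerm (InvAtH)
open B9SupplySockB9P3ZdAllLettersZd (opsAllZd)
open B9Eq327GreenZd (LinearOnDomAt)
open B9Eq327GreenZdHerm (HermPreservingAt LinHermInClassAt PosDefInClassAtH withGopZdH invAtH_withGopZdH_of_posDefH)
open B9Eq316AveragingTransposeZdLevelZero (hbox0_cubeLamBP_of_eq linearOnDomAt_opsAllZd_cubeLamBP linearOnDomAt_opsAllZd_of_unitary₀)
open B9Eq326DeltaAHermitianZdCurved (hermPreservingAt_opsAllZd_of_box)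

-- `Site` alone could resolve to the torus sites of `Setup.lean`; re-export the `ℤ^d` sites of `B7Prop1Explicit`.
export B7Prop1Explicit (Site)

variable {d : ℕ} {𝔸 : Type*} [CStarAlgebra 𝔸] (τ : 𝔸 →ₗ[ℂ] ℂ) [FiniteDimensional ℝ 𝔸] [Nontrivial 𝔸] {L : ℕ}

/-! ## §1 Both structural halves at print's class, every unitary background -/

/-- ★ **`Δ_a(U₀)` OF THE FOUR-LETTER RECORD OVER PRINT'S CLASS `cubeLamBP` IS HERMITIAN-PRESERVING AT EVERY UNITARY BACKGROUND** (cube member `i.Ω = cubeFam false L a M_c ρ i.k`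
with finite `□₀`, `m ≤ i.k`, `2 ≤ L ≤ ρ`; faithful Hermitian tracial `τ`): `hermPreservingAt_opsAllZd_of_box` fed n06-b's P₀ clause `hbox0_cubeLamBP_of_eq`.
[cite: Balaban1985BackgroundPropagators, p.391, (3.26) p.395; Balaban1985RegularSpaces, (1.31) p.82, (1.131) p.99] -/
theorem hermPreservingAt_opsAllZd_cubeLamBP (hτt : ∀ a b : 𝔸, τ (a * b) = τ (b * a)) (hτs : ∀ a : 𝔸, τ (star a) = starRingEnd ℂ (τ a))
    (hτp : ∀ a : 𝔸, a ≠ 0 → 0 < (τ (star a * a)).re) (hL : 2 ≤ L) (ops₀ : ℝ → ZdIdx d L → ℕ → OpsZd d 𝔸) (M : ℝ) (i : ZdIdx d L)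
    {a : Site d} {Mc ρ : ℕ} (hρ : L ≤ ρ) (hΩ : i.Ω = cubeFam false L a Mc ρ i.k) (hfin : (i.Ω 0).Finite) {m : ℕ} (hm : m ≤ i.k)
    {U₀ : Site d → Fin d → 𝔸ˣ} (hU₀ : ∀ x κ, U₀ x κ ∈ unitaryUnits 𝔸) :
    HermPreservingAt i.η (opsAllZd τ L (cubeLamBP L a Mc ρ i.k) ops₀ M i m) (i.Ω 0) U₀ :=
  hermPreservingAt_opsAllZd_of_box τ hτt hτs hτp hL ops₀ M hfin (hbox0_cubeLamBP_of_eq (le_trans (by norm_num) hL) i a Mc hρ hΩ hm) hU₀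

/-- **BOTH STRUCTURAL HALVES AT PRINT'S CLASS, EVERY UNITARY BACKGROUND**: `LinearOnDomAt` (n06-b P₀) ∧ `HermPreservingAt` (§1).
[cite: Balaban1985BackgroundPropagators, (3.26) p.395, p.391] -/
theorem linHerm_opsAllZd_cubeLamBP (hτt : ∀ a b : 𝔸, τ (a * b) = τ (b * a)) (hτs : ∀ a : 𝔸, τ (star a) = starRingEnd ℂ (τ a))
    (hτp : ∀ a : 𝔸, a ≠ 0 → 0 < (τ (star a * a)).re) (hL : 2 ≤ L) (ops₀ : ℝ → ZdIdx d L → ℕ → OpsZd d 𝔸) (M : ℝ) (i : ZdIdx d L)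
    {a : Site d} {Mc ρ : ℕ} (hρ : L ≤ ρ) (hΩ : i.Ω = cubeFam false L a Mc ρ i.k) (hfin : (i.Ω 0).Finite) {m : ℕ} (hm : m ≤ i.k)
    {U₀ : Site d → Fin d → 𝔸ˣ} (hU₀ : ∀ x κ, U₀ x κ ∈ unitaryUnits 𝔸) :
    LinearOnDomAt i.η (opsAllZd τ L (cubeLamBP L a Mc ρ i.k) ops₀ M i m) (i.Ω 0) U₀ ∧
      HermPreservingAt i.η (opsAllZd τ L (cubeLamBP L a Mc ρ i.k) ops₀ M i m) (i.Ω 0) U₀ :=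
  ⟨linearOnDomAt_opsAllZd_cubeLamBP τ hL ops₀ M i hρ hΩ hfin hm hU₀, hermPreservingAt_opsAllZd_cubeLamBP τ hτt hτs hτp hL ops₀ M i hρ hΩ hfin hm hU₀⟩

/-! ## §2 The structural binder `LinHermInClassAt` of the per-member Theorem-3.11 road is a theorem at print's class -/

section Binder

variable {I : Type} (bg : I → B9.Backgrounds) (mem : ℝ → ZdIdx d L → ℕ → I)
variable (ιCfg : ∀ (M : ℝ) (i : ZdIdx d L) (m : ℕ) (U₀ : Site d → Fin d → 𝔸ˣ), (∀ x κ, U₀ x κ ∈ unitaryUnits 𝔸) → (bg (mem M i m)).Cfg)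

/-- ★★ **`LinHermInClassAt` FOR EVERY P₀ BOX-LAW MEMBER** (finite `Ω₀`, `L ≥ 2`, level-`j` class boxes `⊂ Ω_{j−1}` for `1 ≤ j ≤ m`): both halves hold at EVERY unitary background
(`linearOnDomAt_opsAllZd_of_unitary₀` + `hermPreservingAt_opsAllZd_of_box`), so the binder holds for every `(c₃₅, a₃)` and at ANY background frame `bg ∕ ιCfg`.
[cite: Balaban1985BackgroundPropagators, (3.26) p.395, Thm 3.11 p.416; Balaban1985RegularSpaces, (1.31) p.82] -/
theorem linHermInClassAt_opsAllZd_of_box (hτt : ∀ a b : 𝔸, τ (a * b) = τ (b * a)) (hτs : ∀ a : 𝔸, τ (star a) = starRingEnd ℂ (τ a))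
    (hτp : ∀ a : 𝔸, a ≠ 0 → 0 < (τ (star a * a)).re) (hL : 2 ≤ L) (ΛbP : ℕ → ℕ → Set (Site d × Fin d))
    (ops₀ : ℝ → ZdIdx d L → ℕ → OpsZd d 𝔸) (M : ℝ) (i : ZdIdx d L) (m : ℕ) (hfin : (i.Ω 0).Finite)
    (hbox : ∀ j, 1 ≤ j → j ≤ m → ∀ c ∈ ΛbP m j, ∀ x, InBox (loK L j c.1) (bondHiK L j c.1 c.2) x → x ∈ i.Ω (j - 1)) (c35 a₃ : ℝ) :
    LinHermInClassAt bg mem ιCfg (opsAllZd τ L ΛbP ops₀) c35 a₃ M i m :=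
  fun _ _ hU₀ _ _ _ =>
    ⟨linearOnDomAt_opsAllZd_of_unitary₀ τ L ΛbP ops₀ M i m hL hfin hbox hU₀, hermPreservingAt_opsAllZd_of_box τ hτt hτs hτp hL ops₀ M hfin hbox hU₀⟩

/-- ★★★ **`LinHermInClassAt` AT PRINT'S CLASS `cubeLamBP` OF A CUBE MEMBER, FOR EVERY `(c₃₅, a₃)` AND ANY BACKGROUND FRAME** — the structural binder of
`B9Eq327GreenZdHerm.invAtH_withGopZdH_of_posDefH` is a THEOREM for the four-letter record over print's class. [cite: Balaban1985BackgroundPropagators, (3.26) p.395, Thm 3.11 p.416; Balaban1985RegularSpaces, (1.31) p.82, (1.131) p.99] -/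
theorem linHermInClassAt_opsAllZd_cubeLamBP (hτt : ∀ a b : 𝔸, τ (a * b) = τ (b * a)) (hτs : ∀ a : 𝔸, τ (star a) = starRingEnd ℂ (τ a))
    (hτp : ∀ a : 𝔸, a ≠ 0 → 0 < (τ (star a * a)).re) (hL : 2 ≤ L) (ops₀ : ℝ → ZdIdx d L → ℕ → OpsZd d 𝔸) (M : ℝ) (i : ZdIdx d L)
    {a : Site d} {Mc ρ : ℕ} (hρ : L ≤ ρ) (hΩ : i.Ω = cubeFam false L a Mc ρ i.k) (hfin : (i.Ω 0).Finite) {m : ℕ} (hm : m ≤ i.k) (c35 a₃ : ℝ) :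
    LinHermInClassAt bg mem ιCfg (opsAllZd τ L (cubeLamBP L a Mc ρ i.k) ops₀) c35 a₃ M i m :=
  linHermInClassAt_opsAllZd_of_box τ bg mem ιCfg hτt hτs hτp hL _ ops₀ M i m hfin (hbox0_cubeLamBP_of_eq (le_trans (by norm_num) hL) i a Mc hρ hΩ hm) c35 a₃

/-- ★★★ **AT PRINT'S CLASS, `InvAtH` FOR `G_𝔤` FOLLOWS FROM THEOREM 3.11's POSITIVITY ALONE**: for the four-letter record over `cubeLamBP` at a cube member with finite `□₀`,
`PosDefInClassAtH ⟹ InvAtH (withGopZdH (opsAllZd …))` — dag-n06-b's `invAtH_withGopZdH_of_posDefH` with `LinHermInClassAt` discharged (§2).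
[cite: Balaban1985BackgroundPropagators, (3.27) p.395, Thm 3.11 p.416; Balaban1985RegularSpaces, (1.58) p.86] -/
theorem invAtH_withGopZdH_opsAllZd_cubeLamBP_of_posDefH (hτt : ∀ a b : 𝔸, τ (a * b) = τ (b * a))
    (hτs : ∀ a : 𝔸, τ (star a) = starRingEnd ℂ (τ a)) (hτp : ∀ a : 𝔸, a ≠ 0 → 0 < (τ (star a * a)).re) (hL : 2 ≤ L)
    (ops₀ : ℝ → ZdIdx d L → ℕ → OpsZd d 𝔸) (M : ℝ) (i : ZdIdx d L)
    {a : Site d} {Mc ρ : ℕ} (hρ : L ≤ ρ) (hΩ : i.Ω = cubeFam false L a Mc ρ i.k) (hfin : (i.Ω 0).Finite) {m : ℕ} (hm : m ≤ i.k) (c35 a₃ : ℝ)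
    (hpos : PosDefInClassAtH τ bg mem ιCfg (opsAllZd τ L (cubeLamBP L a Mc ρ i.k) ops₀) c35 a₃ M i m) :
    InvAtH bg L mem ιCfg (withGopZdH (opsAllZd τ L (cubeLamBP L a Mc ρ i.k) ops₀)) c35 a₃ M i m :=
  invAtH_withGopZdH_of_posDefH τ bg mem ιCfg _ c35 a₃ M i m hfin
    (linHermInClassAt_opsAllZd_cubeLamBP τ bg mem ιCfg hτt hτs hτp hL ops₀ M i hρ hΩ hfin hm c35 a₃) hpos

/-- ★★ **THE SAME FOR EVERY P₀ BOX-LAW MEMBER.** [cite: Balaban1985BackgroundPropagators, (3.27) p.395, Thm 3.11 p.416; Balaban1985RegularSpaces, (1.31) p.82, (1.58) p.86] -/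
theorem invAtH_withGopZdH_opsAllZd_of_box_of_posDefH (hτt : ∀ a b : 𝔸, τ (a * b) = τ (b * a))
    (hτs : ∀ a : 𝔸, τ (star a) = starRingEnd ℂ (τ a)) (hτp : ∀ a : 𝔸, a ≠ 0 → 0 < (τ (star a * a)).re) (hL : 2 ≤ L)
    (ΛbP : ℕ → ℕ → Set (Site d × Fin d)) (ops₀ : ℝ → ZdIdx d L → ℕ → OpsZd d 𝔸) (M : ℝ) (i : ZdIdx d L) (m : ℕ) (hfin : (i.Ω 0).Finite)
    (hbox : ∀ j, 1 ≤ j → j ≤ m → ∀ c ∈ ΛbP m j, ∀ x, InBox (loK L j c.1) (bondHiK L j c.1 c.2) x → x ∈ i.Ω (j - 1)) (c35 a₃ : ℝ)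
    (hpos : PosDefInClassAtH τ bg mem ιCfg (opsAllZd τ L ΛbP ops₀) c35 a₃ M i m) :
    InvAtH bg L mem ιCfg (withGopZdH (opsAllZd τ L ΛbP ops₀)) c35 a₃ M i m :=
  invAtH_withGopZdH_of_posDefH τ bg mem ιCfg _ c35 a₃ M i m hfin
    (linHermInClassAt_opsAllZd_of_box τ bg mem ιCfg hτt hτs hτp hL ΛbP ops₀ M i m hfin hbox c35 a₃) hpos

end Binder

end Literature.MathematicalPhysics.QuantumFieldTheory.Balaban1983to89.B9Thm311LinHermCubeZd

end
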